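import Literature.Analysis.FluidPDE.VeryWeakLqMild
import Literature.Analysis.FluidPDE.LpMildKatoClassical
import Literature.Analysis.FluidPDE.KatoLocalL3Exists
import Literature.Analysis.FluidPDE.ClassicalL3Mild
import Literature.Analysis.FluidPDE.ClassicalSuitableRegionEnergy
import HarnessLib

/-!
# Interior `L^∞` bounds for classical `C_t L^p` solutions of Navier–Stokes, `p ≥ 3`

Analysis/FluidPDE proofs file (theorems only: no definitions, no named facts) on the discharge
path of `Literature.Analysis.FluidPDE.chae2007_asymptoticallySelfSimilar_local` (D. Chae, Math. Ann.
338 (2007), Thm 1.5; the remaining input, a suitable representative up to the blow-up time, is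
local Leray theory, whose weak–strong uniqueness needs the classical solution to be bounded, with
bounded gradient, on interior time windows). Let `(v, π)` be a classical solution of the unforced
Navier–Stokes system (`ν = 1`) on `ℝ³ × (0, T)` with `v ∈ C([0, T); L^p)`, `3 ≤ p < ∞`. Then on every
compact interior time window `[a, b] ⊂ (0, T)` the field `v` and its spatial gradient are bounded on
`[a, b] × ℝ³` (`ClassicalLpBounds.classical_interior_bounds`). Smoothness alone does not give this
(smooth functions need not be bounded in `x`); the bound is Kato's (Math. Z. 187 (1984), Thm. 1:
`√t u ∈ L^∞`) with the smoothing of Koch–Nadirashvili–Seregin–Šverák (2009, Prop. 4.1: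
`t^{1/2} ∇u ∈ L^∞`), reached through the tree's duality route: the classical solution is a very
weak solution with continuous `L^p` slices on interior windows, hence mild
(`VeryWeakLqMild.isMildNSSolutionBetween_of_veryWeak`, no pressure needed), hence represented by
Kato's `L^p` solution and by the smooth solution of the integral equation
(`LpMildKato.exists_kato_time`, `LpMildKato.exists_smooth_window`), which coincide with the
classical solution pointwise, both being continuous. For `p = 3` the tree's `L³` theory
(`mild_L3_interior_bounded_holds`) first gives an `L^∞` bound on interior windows, whence continuity
in `L⁴` and the case `p = 4`.

* `exists_window`, `window_hypotheses` — the classical solution restricted to an interior window,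
  extended by zero, satisfies the hypotheses of Kato's `L^p` route;
* `exists_bounds_nhds` — bounds near each interior time (Kato's representative and the smooth
  window, identification of continuous representatives);
* `interior_bounds_gt_three` — compactness in time;
* `interior_bounds_three` — the case `p = 3` through `L⁴`;
* **`classical_interior_bounds`** — the statement for all `3 ≤ p < ∞`.

## References

* T. Kato, Math. Z. 187 (1984), Thm. 1 [Kato1984].
* G. Koch, N. Nadirashvili, G. Seregin, V. Šverák, Acta Math. 203 (2009), Prop. 4.1
  [KochNadirashviliSereginSverak2009].
* E. B. Fabes, B. F. Jones, N. M. Rivière, Arch. Rational Mech. Anal. 45 (1972), Thm. 2.1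
  [FabesJonesRiviere1972].
-/

noncomputable section

open _root_.MeasureTheory Set Function Filter Metric TopologicalSpace InnerProductSpace
open scoped NNReal ENNReal _root_.Topology RealInnerProductSpace Laplacian ContDiff

namespace Literature.Analysis.FluidPDE

namespace ClassicalLpBounds

/-- Local notation for physical space `ℝ³ = EuclideanSpace ℝ (Fin 3)`. -/
local notation "ℝ³" => EuclideanSpace ℝ (Fin 3)

/-! ### Tools -/

section Tools

/-- **An a.e. bound of a continuous field holds everywhere** (the exceptional set is open and
null, hence empty). [folklore] -/
theorem forall_norm_le_of_ae {F : Type*} [NormedAddCommGroup F] {f : ℝ³ → F} (hf : Continuous f)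
    {M : ℝ} (h : ∀ᵐ x ∂(volume : Measure ℝ³), ‖f x‖ ≤ M) : ∀ x, ‖f x‖ ≤ M := by
  have hopen : IsOpen {x : ℝ³ | M < ‖f x‖} := isOpen_lt continuous_const hf.norm
  have hnull : volume {x : ℝ³ | M < ‖f x‖} = 0 := by
    have h' := ae_iff.1 h
    simpa only [not_le] using h'
  have hempty := (hopen.measure_eq_zero_iff volume).1 hnull
  intro x
  by_contra hx
  have hmem : x ∈ {x : ℝ³ | M < ‖f x‖} := not_le.1 hx
  rw [hempty] at hmem
  exact hmem

/-- **Two continuous fields which agree a.e. agree everywhere.** [folklore] -/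
theorem eq_of_ae_eq_of_continuous {F : Type*} [NormedAddCommGroup F] {f g : ℝ³ → F}
    (hf : Continuous f) (hg : Continuous g) (h : f =ᵐ[volume] g) : f = g :=
  (Continuous.ae_eq_iff_eq volume hf hg).1 h

end Tools

/-! ### The classical solution on an interior window, extended by zero -/

section Window

variable {T : ℝ} {v : ℝ → ℝ³ → ℝ³} {π : ℝ → ℝ³ → ℝ}

/-- **The window field**: for a classical solution `(v, π)` on `(0, T)` and `0 < a'' < b'' < T`,
the field `U(τ) = v(τ + a'')` for `τ ∈ [0, b'' − a'')`, `U(τ) = 0` otherwise, is jointly (strongly)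
measurable (it is continuous on the measurable piece `[0, b'' − a'') × ℝ³`, Mathlib's
`ContinuousOn.measurable_piecewise`). [folklore] -/
theorem exists_window (hv : IsClassicalNSSolutionOn (Ioo 0 T) 1 0 v π) {a'' b'' : ℝ}
    (ha : 0 < a'') (hb : b'' < T) :
    ∃ U : ℝ → ℝ³ → ℝ³, StronglyMeasurable (uncurry U) ∧
      ∀ τ ∈ Ico 0 (b'' - a''), U τ = v (τ + a'') := by
  classical
  set s : Set (ℝ × ℝ³) := Ico 0 (b'' - a'') ×ˢ (univ : Set ℝ³) with hs
  set f : ℝ × ℝ³ → ℝ³ := fun q => v (q.1 + a'') q.2 with hf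
  have hsm : MeasurableSet s := measurableSet_Ico.prod MeasurableSet.univ
  have hcont : ContinuousOn f s := by
    have h1 : ContinuousOn (uncurry v) (Ioo 0 T ×ˢ univ) := hv.smooth_velocity.continuousOn
    have h2 : Continuous fun q : ℝ × ℝ³ => ((q.1 + a'', q.2) : ℝ × ℝ³) := by fun_prop
    refine (h1.comp h2.continuousOn fun q hq => ?_)
    have hq1 := (mem_prod.1 hq).1
    exact ⟨⟨by linarith [hq1.1], by linarith [hq1.2]⟩, mem_univ _⟩
  have hmeas : Measurable (s.piecewise f 0) :=
    hcont.measurable_piecewise continuousOn_const hsm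
  refine ⟨fun τ x => s.piecewise f 0 (τ, x), hmeas.stronglyMeasurable, fun τ hτ => ?_⟩
  funext x
  have hmem : ((τ, x) : ℝ × ℝ³) ∈ s := ⟨hτ, mem_univ _⟩
  simp only [Set.piecewise_eq_of_mem _ _ _ hmem, hf]

/-- **The hypotheses of Kato's `L^p` route on the window.** Let `(v, π)` be a classical solution
of the unforced Navier–Stokes system (`ν = 1`) on `(0, T)`, `3 < p < ∞`, `0 < a'' < b'' < T`,
`v ∈ C([a'', b'']; L^p)`, and let `U` be the window field of `exists_window`. Then on the slab
`(0, b'' − a'')`: the slices of `U` are bounded in `L^p`, in `L^p`, weakly divergence free, and `U`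
satisfies the two-time duality (mild) identity between all `0 < s ≤ t < b'' − a''`
(classical ⇒ very weak — the distributional identity of `ClassicalSuitableRegion`, the pressure
term dropping out for divergence-free test fields — and very weak with continuous `L^p` slices ⇒
mild, `VeryWeakLqMild.isMildNSSolutionBetween_of_veryWeak`). [cite: FabesJonesRiviere1972, Thm. 2.1] -/
theorem window_hypotheses (hv : IsClassicalNSSolutionOn (Ioo 0 T) 1 0 v π) {p : ℝ≥0∞}
    (hp₃ : 3 < p) (hp : p < ⊤) {a'' b'' : ℝ} (ha : 0 < a'') (hab : a'' < b'') (hb : b'' < T)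
    (hcont : ContinuousInLpOn (Icc a'' b'') p v) {U : ℝ → ℝ³ → ℝ³}
    (hUm : StronglyMeasurable (uncurry U)) (hU : ∀ τ ∈ Ico 0 (b'' - a''), U τ = v (τ + a'')) :
    ∃ M : ℝ≥0, (∀ τ ∈ Ico 0 (b'' - a''), eLpNorm (U τ) p volume ≤ M) ∧
      (∀ τ ∈ Ico 0 (b'' - a''), MemLp (U τ) p volume) ∧
      (∀ τ ∈ Ico 0 (b'' - a''), IsWeaklyDivFree (U τ)) ∧
      ∀ ⦃s t : ℝ⦄, 0 < s → s ≤ t → t < b'' - a'' → IsMildNSSolutionBetween 1 0 U s t := by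
  set S : ℝ := b'' - a'' with hSdef
  have hS : 0 < S := sub_pos.2 hab
  have hp1 : 1 ≤ p := (lt_trans (by norm_num) hp₃).le
  have hr3 := KatoLp.three_lt_toReal hp₃ hp
  have hr2 : (2 : ℝ) < p.toReal := by linarith
  have hpr : ENNReal.ofReal p.toReal = p := ENNReal.ofReal_toReal hp.ne
  -- the `L^p` bound on the compact window
  obtain ⟨M, hM⟩ := ContinuousInLpOn.exists_forall_eLpNorm_le hcont hp1 isCompact_Icc Subset.rfl
  have hshift : ∀ τ ∈ Ico 0 S, τ + a'' ∈ Icc a'' b'' := fun τ hτ =>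
    ⟨by linarith [hτ.1], by linarith [hτ.2]⟩
  have hshiftT : ∀ τ ∈ Ico 0 S, τ + a'' ∈ Ioo 0 T := fun τ hτ =>
    ⟨by linarith [hτ.1], by linarith [hτ.2]⟩
  have hUM : ∀ τ ∈ Ico 0 S, eLpNorm (U τ) p volume ≤ M := fun τ hτ => by
    rw [hU τ hτ]; exact hM _ (hshift τ hτ)
  have hUp : ∀ τ ∈ Ico 0 S, MemLp (U τ) p volume := fun τ hτ => by
    rw [hU τ hτ]; exact hcont.1 _ (hshift τ hτ)
  have hUdiv : ∀ τ ∈ Ico 0 S, IsWeaklyDivFree (U τ) := fun τ hτ => by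
    rw [hU τ hτ]
    exact VectorCalculus.IsDivFree.isWeaklyDivFree_holds (hv.divFree _ (hshiftT τ hτ))
      (contDiff_infty.1 (hv.contDiff_velocity (hshiftT τ hτ)) 1)
  refine ⟨M, hUM, hUp, hUdiv, fun s t hs hst htS => ?_⟩
  -- ### the very weak identity on the slab, from the classical equations
  have hcl := (hv.comp_add_right a'').onRegion
  set O : Set (ℝ × ℝ³) := ((fun t => t + a'') ⁻¹' Ioo 0 T) ×ˢ (univ : Set ℝ³) with hO
  have hOopen : IsOpen O :=
    ((isOpen_Ioo (a := (0 : ℝ)) (b := T)).preimage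
      (continuous_id.add continuous_const : Continuous fun t : ℝ => t + a'')).prod isOpen_univ
  have hQO : ((slab ℝ³ (Ioo 0 S) isOpen_Ioo : Opens (ℝ × ℝ³)) : Set (ℝ × ℝ³)) ⊆ O := by
    intro ζ hζ
    have h1 := mem_slab.1 hζ
    refine ⟨?_, mem_univ _⟩
    show ζ.1 + a'' ∈ Ioo 0 T
    exact ⟨by linarith [h1.1], by linarith [h1.2, hSdef]⟩
  have hdist := hcl.isDistributionalNSSolutionOn hOopen (Q := slab ℝ³ (Ioo 0 S) isOpen_Ioo) hQO
  have hweak : ∀ χ : ℝ → ℝ³ → ℝ³, IsSpaceTimeTestOn (slab ℝ³ (Ioo 0 S) isOpen_Ioo) χ →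
      (∀ t, VectorCalculus.IsDivFree (χ t)) →
      ∫ ζ in Ioo 0 S ×ˢ (univ : Set ℝ³), veryWeakIntegrand 1 U χ ζ = 0 := by
    intro χ hχ hdivχ
    have key := hdist.2.2.2.2 χ hχ
    have hQ : ((slab ℝ³ (Ioo 0 S) isOpen_Ioo : Opens (ℝ × ℝ³)) : Set (ℝ × ℝ³)) =
        Ioo 0 S ×ˢ (univ : Set ℝ³) := rfl
    rw [hQ] at key
    refine Eq.trans ?_ key
    refine setIntegral_congr_fun ((measurableSet_Ioo : MeasurableSet (Ioo (0 : ℝ) S)).prod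
      (MeasurableSet.univ : MeasurableSet (univ : Set ℝ³))) fun ζ hζ => ?_
    have hζ1 : ζ.1 ∈ Ico 0 S := ⟨(mem_prod.1 hζ).1.1.le, (mem_prod.1 hζ).1.2⟩
    have hUζ : U ζ.1 = v (ζ.1 + a'') := hU _ hζ1
    rw [veryWeakIntegrand_apply, hUζ, hdivχ ζ.1 ζ.2]
    simp
  -- ### measurability and continuity in `L^p` on the open slab
  have hum : AEStronglyMeasurable (uncurry U) (volume.restrict (Ioo 0 S ×ˢ (univ : Set ℝ³))) :=
    hUm.aestronglyMeasurable
  have huc : ContinuousInLpOn (Ioo 0 S) (ENNReal.ofReal p.toReal) U := by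
    rw [hpr]
    refine ⟨fun τ hτ => hUp τ ⟨hτ.1.le, hτ.2⟩, fun τ₀ hτ₀ => ?_⟩
    have hτ₀' : τ₀ ∈ Ico 0 S := ⟨hτ₀.1.le, hτ₀.2⟩
    have hc := hcont.2 (τ₀ + a'') (hshift τ₀ hτ₀')
    have hmap : Tendsto (fun τ : ℝ => τ + a'') (𝓝[Ioo 0 S] τ₀) (𝓝[Icc a'' b''] (τ₀ + a'')) :=
      (continuous_id.add continuous_const).continuousWithinAt.tendsto_nhdsWithin
        fun τ hτ => hshift τ ⟨hτ.1.le, hτ.2⟩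
    refine ((hc.comp hmap).congr' ?_)
    filter_upwards [self_mem_nhdsWithin] with τ hτ
    simp only [Function.comp_apply]
    rw [hU τ ⟨hτ.1.le, hτ.2⟩, hU τ₀ hτ₀']
  have huM : ∀ τ ∈ Ioo 0 S, eLpNorm (U τ) (ENNReal.ofReal p.toReal) volume ≤ M := fun τ hτ => by
    rw [hpr]; exact hUM τ ⟨hτ.1.le, hτ.2⟩
  have hdiv' : ∀ τ ∈ Ioo 0 S, IsWeaklyDivFree (U τ) := fun τ hτ => hUdiv τ ⟨hτ.1.le, hτ.2⟩
  exact VeryWeakLqMild.isMildNSSolutionBetween_of_veryWeak one_pos hr2 hum huc huM hdiv' hweak hs hst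
    htS

end Window

/-! ### Bounds near each interior time, `3 < p < ∞` -/

section Nhds

variable {T : ℝ} {v : ℝ → ℝ³ → ℝ³} {π : ℝ → ℝ³ → ℝ}

/-- The slices of a jointly smooth field on an open time window are continuous. [folklore] -/
theorem continuous_slice_of_isSmoothSpaceTimeOn {W : ℝ → ℝ³ → ℝ³} {I : Set ℝ}
    (h : IsSmoothSpaceTimeOn I W) {t : ℝ} (ht : t ∈ I) : Continuous (W t) := by
  have h1 : ContinuousOn (uncurry W) (I ×ˢ univ) := h.continuousOn
  have h2 : ContinuousOn (uncurry W ∘ fun x : ℝ³ => (t, x)) univ :=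
    h1.comp (continuousOn_const.prodMk continuousOn_id) (fun x _ => ⟨ht, mem_univ _⟩)
  exact continuousOn_univ.1 h2

set_option maxHeartbeats 1600000 in
/-- **Bounds near each interior time** (Kato 1984, Thm. 1, `√t u ∈ L^∞`; KNSS 2009, Prop. 4.1,
`t^{1/2}∇u ∈ L^∞`). Let `(v, π)` be a classical solution of the unforced Navier–Stokes system
(`ν = 1`) on `(0, T)` with `v ∈ C([a'', b'']; L^p)`, `3 < p < ∞`, `0 < a'' < b'' < T`. Then every
`t* ∈ (a'', b'')` has a time neighbourhood on which `v` and `∇v` are bounded on all of `ℝ³`.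
Proof: restart the window field at `s₀ = t* − a'' − 7κ'/8` (`κ'` below Kato's time for the `L^p`
bound of the window); Kato's representative (`LpMildKato.exists_kato_time`) and the smooth window
(`LpMildKato.exists_smooth_window`) after `s₀ + κ'/2`; the smooth field and `v` are continuous and
a.e. equal, hence equal, on the times `(t* − κ'/8, t* + κ'/8)`. [cite: Kato1984, Thm. 1; KochNadirashviliSereginSverak2009, Prop. 4.1] -/
theorem exists_bounds_nhds (hv : IsClassicalNSSolutionOn (Ioo 0 T) 1 0 v π) {p : ℝ≥0∞}
    (hp₃ : 3 < p) (hp : p < ⊤) {a'' b'' : ℝ} (ha : 0 < a'') (hab : a'' < b'') (hb : b'' < T)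
    (hcont : ContinuousInLpOn (Icc a'' b'') p v) {tstar : ℝ} (ht : tstar ∈ Ioo a'' b'') :
    ∃ ε : ℝ, 0 < ε ∧ ∃ Mb L : ℝ, ∀ θ ∈ Ioo (tstar - ε) (tstar + ε), ∀ x,
      ‖v θ x‖ ≤ Mb ∧ ‖fderiv ℝ (v θ) x‖ ≤ L := by
  set S : ℝ := b'' - a'' with hSdef
  have hS : 0 < S := sub_pos.2 hab
  -- the window field and its hypotheses
  obtain ⟨U, hUm, hU⟩ := exists_window hv ha hb
  obtain ⟨M, hUM, hUp, hUdiv, hmild⟩ := window_hypotheses hv hp₃ hp ha hab hb hcont hUm hU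
  have huM : ∀ τ ∈ Ioo 0 S, eLpNorm (U τ) p volume ≤ M := fun τ hτ => hUM τ ⟨hτ.1.le, hτ.2⟩
  have hdiv : ∀ τ ∈ Ioo 0 S, IsWeaklyDivFree (U τ) := fun τ hτ => hUdiv τ ⟨hτ.1.le, hτ.2⟩
  -- Kato's time for the bound `M`
  obtain ⟨κ, hκ, Cb, hCb0, H⟩ := LpMildKato.exists_kato_time (p := p) hp₃ hp M
  set d₁ : ℝ := tstar - a'' with hd₁
  set d₂ : ℝ := b'' - tstar with hd₂
  have hd₁0 : 0 < d₁ := sub_pos.2 ht.1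
  have hd₂0 : 0 < d₂ := sub_pos.2 ht.2
  set κ' : ℝ := min κ (min d₁ d₂) with hκ'
  have hκ'0 : 0 < κ' := lt_min hκ (lt_min hd₁0 hd₂0)
  have hκ'κ : κ' ≤ κ := min_le_left _ _
  have hκ'd₁ : κ' ≤ d₁ := (min_le_right _ _).trans (min_le_left _ _)
  have hκ'd₂ : κ' ≤ d₂ := (min_le_right _ _).trans (min_le_right _ _)
  -- the restart time `s₀`
  set s₀ : ℝ := d₁ - 7 * κ' / 8 with hs₀def
  have hs₀0 : 0 < s₀ := by rw [hs₀def]; linarith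
  have hs₀S : s₀ + κ' ≤ S := by rw [hs₀def, hSdef, hd₁]; linarith
  have hs₀ : s₀ ∈ Ioo 0 S := ⟨hs₀0, by linarith⟩
  obtain ⟨hũm, hũ0, hũ0p, hdivũ0, hũM, hdivũ, hmildũ⟩ :=
    LpMildKato.restart_hypotheses hUm huM hdiv hmild hs₀
  have hu0M : eLpNorm ((fun τ => U (τ + s₀)) 0) p volume ≤ M := by
    show eLpNorm (U (0 + s₀)) p volume ≤ M
    rw [zero_add]
    exact hUM s₀ ⟨hs₀0.le, hs₀.2⟩
  have hT : 0 < S - s₀ := sub_pos.2 hs₀.2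
  obtain ⟨uK, hKm, hKb, hae⟩ := H hũm hũ0 hũ0p hu0M hdivũ0 hT hũM hdivũ hmildũ
  have hκ'le : κ' ≤ min (S - s₀) κ := le_min (by linarith) hκ'κ
  have hKb' : ∀ t ∈ Ioo 0 κ', ∀ x, ‖uK t x‖ ≤ Cb * t ^ (-(1 / 2 : ℝ)) := fun t ht' x =>
    hKb t ⟨ht'.1, ht'.2.trans_le hκ'le⟩ x
  have hae₁ : ∀ t ∈ Ioo 0 κ', U (t + s₀) =ᵐ[volume] uK t := fun t ht' =>
    hae t ⟨ht'.1, ht'.2.trans_le hκ'le⟩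
  -- the smooth window after `s₀ + κ'/2`
  obtain ⟨W, hsmooth, hWu, hWb, hder, -⟩ :=
    LpMildKato.exists_smooth_window hp₃ hp hUm huM hdiv hmild hs₀ hκ'0 hs₀S hKm hKb' hae₁
  obtain ⟨C₁, hC₁⟩ := hder 1 0
  -- the identification `W t = v (t + s₀ + κ'/2 + a'')` on `(0, κ'/2)`
  have hident : ∀ t ∈ Ioo 0 (κ' / 2), W t = v (t + s₀ + κ' / 2 + a'') := by
    intro t htI
    have hmem : t + (s₀ + κ' / 2) ∈ Ico 0 S := ⟨by linarith [htI.1], by linarith [htI.2]⟩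
    have hθT : t + s₀ + κ' / 2 + a'' ∈ Ioo 0 T := ⟨by linarith [htI.1], by linarith [htI.2, hSdef]⟩
    have h1 : W t =ᵐ[volume] v (t + s₀ + κ' / 2 + a'') := by
      have h := hWu t htI
      rw [hU _ hmem, show t + (s₀ + κ' / 2) + a'' = t + s₀ + κ' / 2 + a'' by ring] at h
      exact h
    exact eq_of_ae_eq_of_continuous (continuous_slice_of_isSmoothSpaceTimeOn hsmooth htI)
      (hv.contDiff_velocity hθT).continuous h1
  -- the gradient bound in pointwise form
  have hgrad : ∀ t ∈ Ioo 0 (κ' / 2), ∀ x, t ^ ((1 : ℝ) / 2) * ‖fderiv ℝ (W t) x‖ ≤ C₁ := by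
    intro t htI x
    have hb0 := hC₁ t htI x
    have hnorm : ‖iteratedFDeriv ℝ 1 (fun y => iteratedDeriv 0 (fun τ => W τ y) t) x‖ =
        ‖fderiv ℝ (W t) x‖ := by
      have hfun : (fun y => iteratedDeriv 0 (fun τ => W τ y) t) = W t := by
        funext y; rw [iteratedDeriv_zero]
      rw [hfun]
      have h1 := norm_iteratedFDeriv_fderiv (𝕜 := ℝ) (f := W t) (x := x) (n := 0)
      rw [norm_iteratedFDeriv_zero] at h1
      rw [← h1]
    have hexp : ((1 : ℕ) : ℝ) / 2 + ((0 : ℕ) : ℝ) = (1 : ℝ) / 2 := by norm_num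
    rw [hexp, hnorm, sub_zero] at hb0
    exact hb0
  -- ### the neighbourhood `(t* - κ'/8, t* + κ'/8)`
  set Mb : ℝ := |Cb| * (κ' / 2) ^ (-(1 / 2 : ℝ)) with hMb
  set c₀ : ℝ := (κ' / 4) ^ ((1 : ℝ) / 2) with hc₀
  have hc₀pos : 0 < c₀ := Real.rpow_pos_of_pos (by positivity) _
  refine ⟨κ' / 8, by positivity, Mb, C₁ / c₀, fun θ hθ x => ?_⟩
  set t : ℝ := θ - s₀ - κ' / 2 - a'' with htdef
  have htI : t ∈ Ioo 0 (κ' / 2) := by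
    rw [htdef, hs₀def, hd₁]
    constructor <;> linarith [hθ.1, hθ.2]
  have ht4 : κ' / 4 ≤ t := by rw [htdef, hs₀def, hd₁]; linarith [hθ.1]
  have hθeq : θ = t + s₀ + κ' / 2 + a'' := by rw [htdef]; ring
  have hWv : W t = v θ := by rw [hθeq]; exact hident t htI
  refine ⟨?_, ?_⟩
  · rw [← hWv]; exact hWb t htI x
  · rw [← hWv, le_div_iff₀ hc₀pos]
    calc ‖fderiv ℝ (W t) x‖ * c₀ ≤ ‖fderiv ℝ (W t) x‖ * t ^ ((1 : ℝ) / 2) := by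
          refine mul_le_mul_of_nonneg_left ?_ (norm_nonneg _)
          exact Real.rpow_le_rpow (by positivity) ht4 (by norm_num)
      _ = t ^ ((1 : ℝ) / 2) * ‖fderiv ℝ (W t) x‖ := mul_comm _ _
      _ ≤ C₁ := hgrad t htI x

/-- **Interior bounds on compact windows, `3 < p < ∞`** (compactness in time over the
neighbourhoods of `exists_bounds_nhds`): for `v ∈ C([a'', b'']; L^p)` and `a'' < a ≤ b < b''`,
`v` and `∇v` are bounded on `[a, b] × ℝ³`. [cite: Kato1984, Thm. 1; KochNadirashviliSereginSverak2009, Prop. 4.1] -/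
theorem interior_bounds_gt_three (hv : IsClassicalNSSolutionOn (Ioo 0 T) 1 0 v π) {p : ℝ≥0∞}
    (hp₃ : 3 < p) (hp : p < ⊤) {a'' b'' : ℝ} (ha : 0 < a'') (hab : a'' < b'') (hb : b'' < T)
    (hcont : ContinuousInLpOn (Icc a'' b'') p v) {a b : ℝ} (haa : a'' < a) (hbb : b < b'') :
    ∃ Mb L : ℝ, ∀ t ∈ Icc a b, ∀ x, ‖v t x‖ ≤ Mb ∧ ‖fderiv ℝ (v t) x‖ ≤ L := by
  -- neighbourhoods and constants at each point of `[a, b]`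
  have hpt : ∀ i : Icc a b, ∃ ε : ℝ, 0 < ε ∧ ∃ Mb L : ℝ,
      ∀ θ ∈ Ioo ((i : ℝ) - ε) ((i : ℝ) + ε), ∀ x, ‖v θ x‖ ≤ Mb ∧ ‖fderiv ℝ (v θ) x‖ ≤ L :=
    fun i => exists_bounds_nhds hv hp₃ hp ha hab hb hcont
      ⟨lt_of_lt_of_le haa i.2.1, lt_of_le_of_lt i.2.2 hbb⟩
  choose ε hε Mb L hbd using hpt
  have hcover : Icc a b ⊆ ⋃ i : Icc a b, Ioo ((i : ℝ) - ε i) ((i : ℝ) + ε i) := by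
    intro t ht
    exact mem_iUnion.2 ⟨⟨t, ht⟩, by constructor <;> linarith [hε ⟨t, ht⟩]⟩
  obtain ⟨F, hF⟩ := isCompact_Icc.elim_finite_subcover
    (fun i : Icc a b => Ioo ((i : ℝ) - ε i) ((i : ℝ) + ε i)) (fun i => isOpen_Ioo) hcover
  refine ⟨∑ i ∈ F, |Mb i|, ∑ i ∈ F, |L i|, fun t ht x => ?_⟩
  obtain ⟨i, hi, hti⟩ : ∃ i ∈ F, t ∈ Ioo ((i : ℝ) - ε i) ((i : ℝ) + ε i) := by
    have h := hF ht
    simp only [mem_iUnion, exists_prop] at h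
    exact h
  obtain ⟨h1, h2⟩ := hbd i t hti x
  have s1 : |Mb i| ≤ ∑ j ∈ F, |Mb j| :=
    Finset.single_le_sum (f := fun j => |Mb j|) (fun j _ => abs_nonneg _) hi
  have s2 : |L i| ≤ ∑ j ∈ F, |L j| :=
    Finset.single_le_sum (f := fun j => |L j|) (fun j _ => abs_nonneg _) hi
  exact ⟨(h1.trans (le_abs_self _)).trans s1, (h2.trans (le_abs_self _)).trans s2⟩

end Nhds

/-! ### The case `p = 3` through `L⁴` -/

section Three

variable {T : ℝ} {v : ℝ → ℝ³ → ℝ³} {π : ℝ → ℝ³ → ℝ}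

/-- **`L⁴` from `L³ ∩ L^∞`**: if `‖f‖_{L^∞} ≤ A` then `‖f‖_{L⁴} ≤ A^{1/4} ‖f‖_{L³}^{3/4}`
(`∫|f|⁴ ≤ A ∫|f|³`). [folklore] -/
theorem eLpNorm_four_le_of_bound {f : ℝ³ → ℝ³} {A : ℝ} (hA : eLpNorm f ⊤ volume ≤ ENNReal.ofReal A) :
    eLpNorm f 4 volume ≤ ENNReal.ofReal A ^ (1 / 4 : ℝ) * eLpNorm f 3 volume ^ (3 / 4 : ℝ) := by
  have e4 : eLpNorm f 4 volume = (∫⁻ x, ‖f x‖ₑ ^ (4 : ℝ)) ^ (1 / 4 : ℝ) := by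
    rw [eLpNorm_eq_lintegral_rpow_enorm_toReal (by norm_num) (by norm_num), ENNReal.toReal_ofNat]
  have e3 : eLpNorm f 3 volume ^ (3 / 4 : ℝ) = (∫⁻ x, ‖f x‖ₑ ^ (3 : ℝ)) ^ (1 / 4 : ℝ) := by
    rw [eLpNorm_eq_lintegral_rpow_enorm_toReal (by norm_num) (by norm_num), ENNReal.toReal_ofNat,
      ← ENNReal.rpow_mul]
    norm_num
  rw [e4, e3]
  rw [eLpNorm_exponent_top] at hA
  have hle : ∫⁻ x, ‖f x‖ₑ ^ (4 : ℝ) ≤ ENNReal.ofReal A * ∫⁻ x, ‖f x‖ₑ ^ (3 : ℝ) := by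
    rw [← lintegral_const_mul' _ _ ENNReal.ofReal_ne_top]
    refine lintegral_mono_ae ?_
    filter_upwards [enorm_ae_le_eLpNormEssSup f volume] with x hx
    have e : ‖f x‖ₑ ^ (4 : ℝ) = ‖f x‖ₑ * ‖f x‖ₑ ^ (3 : ℝ) := by
      rw [show (4 : ℝ) = 1 + 3 by norm_num, ENNReal.rpow_add_of_nonneg _ _ (by norm_num)
        (by norm_num), ENNReal.rpow_one]
    rw [e]
    exact mul_le_mul' (hx.trans hA) le_rfl
  calc (∫⁻ x, ‖f x‖ₑ ^ (4 : ℝ)) ^ (1 / 4 : ℝ)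
      ≤ (ENNReal.ofReal A * ∫⁻ x, ‖f x‖ₑ ^ (3 : ℝ)) ^ (1 / 4 : ℝ) := ENNReal.rpow_le_rpow hle (by norm_num)
    _ = ENNReal.ofReal A ^ (1 / 4 : ℝ) * (∫⁻ x, ‖f x‖ₑ ^ (3 : ℝ)) ^ (1 / 4 : ℝ) :=
        ENNReal.mul_rpow_of_nonneg _ _ (by norm_num)

/-- **`C_t L³` with a uniform `L^∞` bound is `C_t L⁴`** on a time set `S`. [folklore] -/
theorem continuousInLpOn_four_of_three {S : Set ℝ} (h3 : ContinuousInLpOn S 3 v) {A : ℝ}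
    (hA0 : 0 ≤ A) (hA : ∀ t ∈ S, eLpNorm (v t) ⊤ volume ≤ ENNReal.ofReal A) :
    ContinuousInLpOn S 4 v := by
  have hmem : ∀ t ∈ S, MemLp (v t) 4 volume := by
    intro t ht
    refine ⟨(h3.1 t ht).1, lt_of_le_of_lt (eLpNorm_four_le_of_bound (hA t ht)) ?_⟩
    exact ENNReal.mul_lt_top (ENNReal.rpow_lt_top_of_nonneg (by norm_num) ENNReal.ofReal_ne_top)
      (ENNReal.rpow_lt_top_of_nonneg (by norm_num) (h3.1 t ht).2.ne)
  refine ⟨hmem, fun t₀ ht₀ => ?_⟩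
  -- the majorant `(2A)^{1/4} ‖v t - v t₀‖₃^{3/4}`
  have hdiff : ∀ t ∈ S, eLpNorm (v t - v t₀) ⊤ volume ≤ ENNReal.ofReal (2 * A) := by
    intro t ht
    calc eLpNorm (v t - v t₀) ⊤ volume ≤ eLpNorm (v t) ⊤ volume + eLpNorm (v t₀) ⊤ volume :=
          eLpNorm_sub_le (h3.1 t ht).1 (h3.1 t₀ ht₀).1 le_top
      _ ≤ ENNReal.ofReal A + ENNReal.ofReal A := add_le_add (hA t ht) (hA t₀ ht₀)
      _ = ENNReal.ofReal (2 * A) := by rw [← ENNReal.ofReal_add hA0 hA0, two_mul]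
  have hev : ∀ᶠ t in 𝓝[S] t₀, eLpNorm (v t - v t₀) 4 volume ≤
      ENNReal.ofReal (2 * A) ^ (1 / 4 : ℝ) * eLpNorm (v t - v t₀) 3 volume ^ (3 / 4 : ℝ) := by
    filter_upwards [self_mem_nhdsWithin] with t ht
    exact eLpNorm_four_le_of_bound (hdiff t ht)
  have hmaj : Tendsto (fun t => ENNReal.ofReal (2 * A) ^ (1 / 4 : ℝ) *
      eLpNorm (v t - v t₀) 3 volume ^ (3 / 4 : ℝ)) (𝓝[S] t₀) (𝓝 0) := by
    have h1 := h3.2 t₀ ht₀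
    have h2 := ((ENNReal.continuous_rpow_const (y := (3 / 4 : ℝ))).tendsto 0).comp h1
    rw [ENNReal.zero_rpow_of_pos (by norm_num)] at h2
    have h3' := ENNReal.Tendsto.const_mul h2 (Or.inr (ENNReal.rpow_ne_top_of_nonneg
      (by norm_num : (0 : ℝ) ≤ 1 / 4) (ENNReal.ofReal_ne_top (r := 2 * A))))
    rwa [mul_zero] at h3'
  exact tendsto_of_tendsto_of_tendsto_of_le_of_le' tendsto_const_nhds hmaj
    (Eventually.of_forall fun _ => bot_le) hev

set_option maxHeartbeats 800000 in
/-- **Interior `L^∞` bound for classical `C_t L³` solutions** (Kato's `√t u ∈ L^∞` in `L³`, through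
the tree's `mild_L3_interior_bounded_holds`): for a classical solution on `(0, T)` with
`v ∈ C([0,T); L³)` and `0 < a ≤ b < T`, `‖v(t)‖_{L^∞} ≤ M` for all `t ∈ [a, b]` (restart at `a/2`,
where the classical solution is mild in `C_t L³`, `ClassicalL3Mild.isMildNSSolutionOn_of_memLp_three`).
[cite: Kato1984, Thm. 1; Giga1986, Thm. 4] -/
theorem exists_eLpNorm_top_le_three (hv : IsClassicalNSSolutionOn (Ioo 0 T) 1 0 v π)
    (hcont : ContinuousInLpOn (Ico 0 T) 3 v) {a b : ℝ} (ha : 0 < a) (hab : a ≤ b) (hb : b < T) :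
    ∃ A : ℝ, 0 ≤ A ∧ ∀ t ∈ Icc a b, eLpNorm (v t) ⊤ volume ≤ ENNReal.ofReal A := by
  -- restart at `s = a / 2`
  set s : ℝ := a / 2 with hsdef
  have hs0 : 0 < s := by positivity
  set t₁ : ℝ := -(s / 2) with ht₁
  set t₂ : ℝ := (b + T) / 2 - s with ht₂
  have ht₁0 : t₁ < 0 := by rw [ht₁]; linarith
  have ht₂b : b - s < t₂ := by rw [ht₂]; linarith
  set V : ℝ → ℝ³ → ℝ³ := fun τ => v (τ + s) with hV
  set P : ℝ → ℝ³ → ℝ := fun τ => π (τ + s) with hP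
  -- `V` is classical on `(t₁, t₂)`
  have hVcl : IsClassicalNSSolutionOn (Ioo t₁ t₂) 1 0 V P := by
    have h' := hv.comp_add_right s
    have hsub : Ioo t₁ t₂ ⊆ (fun t => t + s) ⁻¹' Ioo 0 T := fun t ht =>
      ⟨by rw [ht₁] at ht; linarith [ht.1], by rw [ht₂] at ht; linarith [ht.2]⟩
    have h2 := h'.mono hsub (uniqueDiffOn_Ioo t₁ t₂)
    have hf : (fun t : ℝ => (0 : ℝ → ℝ³ → ℝ³) (t + s)) = 0 := by funext t; rfl
    rw [hf] at h2
    exact h2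
  -- `L³` bounds on `(t₁, t₂)` from the compact window `[s/2, (b+T)/2] ⊂ [0, T)`
  have hK : Icc (s / 2) ((b + T) / 2) ⊆ Ico 0 T := fun t ht => ⟨by linarith [ht.1], by linarith [ht.2]⟩
  obtain ⟨M3, hM3⟩ := ContinuousInLpOn.exists_forall_eLpNorm_le hcont (by norm_num) isCompact_Icc hK
  have hwin : ∀ τ ∈ Ioo t₁ t₂, τ + s ∈ Icc (s / 2) ((b + T) / 2) := fun τ hτ =>
    ⟨by rw [ht₁] at hτ; linarith [hτ.1], by rw [ht₂] at hτ; linarith [hτ.2]⟩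
  have h3 : ∀ τ ∈ Ioo t₁ t₂, MemLp (V τ) 3 volume := fun τ hτ => hcont.1 _ (hK (hwin τ hτ))
  have hM : ∀ τ ∈ Ioo t₁ t₂, eLpNorm (V τ) 3 volume ≤ M3 := fun τ hτ => hM3 _ (hwin τ hτ)
  have hmild : IsMildNSSolutionOn (Ico 0 t₂) 1 0 (V 0) V :=
    ClassicalL3Mild.isMildNSSolutionOn_of_memLp_three hVcl one_pos ht₁0 h3 hM le_rfl
  -- the hypotheses of `mild_L3_interior_bounded`
  have ht₂0 : 0 < t₂ := by rw [ht₂]; linarith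
  have h0mem : (0 : ℝ) ∈ Ioo t₁ t₂ := ⟨ht₁0, ht₂0⟩
  have hu₀ : MemLp (V 0) 3 volume := h3 0 h0mem
  have hdiv₀ : IsWeaklyDivFree (V 0) :=
    VectorCalculus.IsDivFree.isWeaklyDivFree_holds (hVcl.divFree 0 h0mem)
      (contDiff_infty.1 (hVcl.contDiff_velocity h0mem) 1)
  have hvc : ContinuousInLpOn (Ico 0 t₂) 3 V :=
    hcont.translate_Ico hs0.le (by rw [ht₂]; linarith)
  have hmeas : AEStronglyMeasurable (uncurry V) (volume.restrict (Ioo 0 t₂ ×ˢ univ)) := by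
    have h1 : ContinuousOn (uncurry V) (Ioo t₁ t₂ ×ˢ univ) := hVcl.smooth_velocity.continuousOn
    exact (h1.mono (prod_mono (Ioo_subset_Ioo ht₁0.le le_rfl) Subset.rfl)).aestronglyMeasurable
      (measurableSet_Ioo.prod MeasurableSet.univ)
  set T₁ : ℝ := (b - s + t₂) / 2 with hT₁
  have hT₁mem : T₁ ∈ Ioo 0 t₂ := ⟨by rw [hT₁]; linarith, by rw [hT₁]; linarith⟩
  obtain ⟨C, hC⟩ := mild_L3_interior_bounded_holds one_pos ht₂0 hu₀ hdiv₀ hmild hvc hmeas T₁ hT₁mem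
  -- the bound on `[a, b]`
  set A : ℝ := |C| / Real.sqrt (a / 2) with hA
  have hsq : 0 < Real.sqrt (a / 2) := Real.sqrt_pos.2 (by positivity)
  refine ⟨A, by positivity, fun t ht => ?_⟩
  have hτ : t - s ∈ Ioo 0 T₁ := ⟨by rw [hsdef]; linarith [ht.1], by rw [hT₁]; linarith [ht.2]⟩
  have e : v t = V (t - s) := by simp only [hV, sub_add_cancel]
  rw [e]
  refine (hC _ hτ).trans (ENNReal.ofReal_le_ofReal ?_)
  have hts : Real.sqrt (a / 2) ≤ Real.sqrt (t - s) := Real.sqrt_le_sqrt (by rw [hsdef]; linarith [ht.1])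
  have hst : 0 < Real.sqrt (t - s) := hsq.trans_le hts
  calc C / Real.sqrt (t - s) ≤ |C| / Real.sqrt (t - s) :=
        div_le_div_of_nonneg_right (le_abs_self C) hst.le
    _ ≤ |C| / Real.sqrt (a / 2) := div_le_div_of_nonneg_left (abs_nonneg C) hsq hts

/-- **Interior bounds on compact windows, `p = 3`**: for a classical solution on `(0, T)` with
`v ∈ C([0,T); L³)` and `0 < a ≤ b < T`, `v` and `∇v` are bounded on `[a, b] × ℝ³` (the `L^∞` bound of
`exists_eLpNorm_top_le_three` on a larger interior window makes `v` a `C_t L⁴` family there, and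
`interior_bounds_gt_three` applies with `p = 4`). [cite: Kato1984, Thm. 1; KochNadirashviliSereginSverak2009, Prop. 4.1] -/
theorem interior_bounds_three (hv : IsClassicalNSSolutionOn (Ioo 0 T) 1 0 v π)
    (hcont : ContinuousInLpOn (Ico 0 T) 3 v) {a b : ℝ} (ha : 0 < a) (hab : a ≤ b) (hb : b < T) :
    ∃ Mb L : ℝ, ∀ t ∈ Icc a b, ∀ x, ‖v t x‖ ≤ Mb ∧ ‖fderiv ℝ (v t) x‖ ≤ L := by
  set a'' : ℝ := a / 2 with ha''
  set b'' : ℝ := (b + T) / 2 with hb''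
  have ha''0 : 0 < a'' := by positivity
  have hab'' : a'' < b'' := by rw [ha'', hb'']; linarith
  have hb''T : b'' < T := by rw [hb'']; linarith
  obtain ⟨A, hA0, hA⟩ := exists_eLpNorm_top_le_three hv hcont ha''0 hab''.le hb''T
  have h3 : ContinuousInLpOn (Icc a'' b'') 3 v :=
    hcont.mono fun t ht => ⟨by linarith [ht.1], by linarith [ht.2]⟩
  have h4 : ContinuousInLpOn (Icc a'' b'') 4 v := continuousInLpOn_four_of_three h3 hA0 hA
  exact interior_bounds_gt_three hv (by norm_num) (by norm_num) ha''0 hab'' hb''T h4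
    (by rw [ha'']; linarith) (by rw [hb'']; linarith)

end Three

/-! ### The statement for all `3 ≤ p < ∞` -/

section All

variable {T : ℝ} {v : ℝ → ℝ³ → ℝ³} {π : ℝ → ℝ³ → ℝ}

/-- **Interior `L^∞` bounds for classical `C_t L^p` solutions, `3 ≤ p < ∞`** (Kato 1984, Thm. 1;
KNSS 2009, Prop. 4.1): let `(v, π)` be a classical solution of the unforced Navier–Stokes system
(`ν = 1`) on `ℝ³ × (0, T)` with `v ∈ C([0,T); L^p)`, `3 ≤ p < ∞`. Then for `0 < a ≤ b < T` there are
`M`, `L` with `|v(t, x)| ≤ M` and `|∇v(t, x)| ≤ L` for all `t ∈ [a, b]`, `x ∈ ℝ³`.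
[cite: Kato1984, Thm. 1; KochNadirashviliSereginSverak2009, Prop. 4.1] -/
theorem classical_interior_bounds (hv : IsClassicalNSSolutionOn (Ioo 0 T) 1 0 v π) {p : ℝ≥0}
    (hp : 3 ≤ p) (hcont : ContinuousInLpOn (Ico 0 T) p v) {a b : ℝ} (ha : 0 < a) (hab : a ≤ b)
    (hb : b < T) :
    ∃ Mb L : ℝ, ∀ t ∈ Icc a b, ∀ x, ‖v t x‖ ≤ Mb ∧ ‖fderiv ℝ (v t) x‖ ≤ L := by
  rcases hp.eq_or_lt with h3 | h3
  · have hcont3 : ContinuousInLpOn (Ico 0 T) 3 v := by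
      have : ((p : ℝ≥0) : ℝ≥0∞) = 3 := by rw [← h3]; norm_num
      rwa [this] at hcont
    exact interior_bounds_three hv hcont3 ha hab hb
  · set a'' : ℝ := a / 2 with ha''
    set b'' : ℝ := (b + T) / 2 with hb''
    have ha''0 : 0 < a'' := by positivity
    have hab'' : a'' < b'' := by rw [ha'', hb'']; linarith
    have hb''T : b'' < T := by rw [hb'']; linarith
    have hp₃ : (3 : ℝ≥0∞) < (p : ℝ≥0∞) := by exact_mod_cast h3
    have hcont' : ContinuousInLpOn (Icc a'' b'') (p : ℝ≥0∞) v :=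
      hcont.mono fun t ht => ⟨by linarith [ht.1], by linarith [ht.2]⟩
    exact interior_bounds_gt_three hv hp₃ ENNReal.coe_lt_top ha''0 hab'' hb''T hcont'
      (by rw [ha'']; linarith) (by rw [hb'']; linarith)

end All

end ClassicalLpBounds

end Literature.Analysis.FluidPDE

end
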